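import Summits.NavierStokesRegularity.NavierStokesRegularity.Theorems.FilamentSkeletonRssSkeletonJ1RSingularBranch
import Summits.NavierStokesRegularity.NavierStokesRegularity.Theorems.FilamentSkeletonRssSkeletonJ1RBranchNonlinearity
import Literature.Analysis.ODE.ParameterizationMethod

/-!
# Route `FilamentSkeletonRss` · crux `SkeletonJ1R` (stmt-NavierStokesRegularity-23610) · registered line `streamline_kantorovich_R`
# — brick K-§3b for stub K `KantorovichClosingL`: THE `C¹` UNSTABLE CURVE OF AN EQUILIBRIUM BY THE PARAMETERIZATION METHOD

Hand `ns-filament-21221-p1` (g18), `--supports stmt-NavierStokesRegularity-23610 --as helper`; pure Mathlib + `Literature.Analysis.ODE.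
ParameterizationMethod`, route-independent; tools in `…SkeletonJ1RBranchNonlinearity.lean`, the branch in `…SkeletonJ1RSingularBranch.lean`.

WHAT.  `exists_unstableCurve`: let `f : E → E` (`E` a real Banach space) vanish at `p`, be differentiable on `B(p, ρ₀)` with `Df`
Lipschitz AT `p` (`‖Df(y) − Df(p)‖ ≤ ω‖y − p‖`), and let `A = Df(p)` have the eigenvector `ξ` with eigenvalue `λ > 0` split off by a
bounded operator `Π` — `Π ξ = 0`, `(A − λ)(1 − Π) = 0`, and the growth bound `‖exp(tA) Π v‖ ≤ C e^{λt} ‖Π v‖` for `t ≥ 0` (the rest of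
the linear flow grows NO FASTER than `e^{λt}`; e.g. `1 − Π` the spectral projection onto a top simple eigenvalue).  Then for every cone
aperture `R > 0` there are `δ > 0`, `C₁` and a curve `P : (−δ, δ) → E`, `P(0) = p`, `P′(0) = ξ`, `C¹` on `(−δ, δ)`, solving the SINGULAR
INVARIANCE EQUATION of the parameterization method
  `λ s · P′(s) = f(P(s))`   (`s ∈ (−δ, δ)`),
with `‖P(s) − p − sξ‖ ≤ min (R|s|) (C₁ s²)` and `‖P′(s) − ξ‖ ≤ C₁|s|`.  Consequences (`Literature.Analysis.ODE.IsInvarianceSolutionOn`):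
`isInvarianceSolutionOn_of_hasDerivAt` puts it in the tree's parameterization currency, and `exists_unstableCurve_trajectory`: for every
`s₀ ∈ (−δ, δ)` the curve `t ↦ P(s₀ e^{λt})` solves `x′ = f(x)` for `t ≤ 0` and tends to `p` as `t → −∞` — the unstable streamline
through `p` tangent to `ξ`, WITHOUT a stable/unstable-manifold theorem (K-notes §3 of the lead).  PROOF: `P(s) = p + s q(±s)` with `q`
the nonlinear regular branch of `s q′ = K₀ q + s H_±(s, q)`, `K₀ = λ⁻¹A − 1`, `H_±(s, q) = ±(λs²)⁻¹ g(±s q)`, `g(v) = f(p+v) − Av`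
(`…SkeletonJ1RSingularBranch.exists_singularBranch`); `g` is `ω r`-Lipschitz on `B̄(0, r)` by the mean-value inequality, so `H_±` is
bounded by `ω(‖ξ‖+R)²/λ` and `ω(‖ξ‖+R)/λ`-Lipschitz in `q`.

HONEST FRAMING.  A generic ODE theorem, sub-brick of the OPEN stub K (the object `Φ¹` of K-notes §1 at the waist zero); stub K, crux 23610
and its heart stay OPEN; MODEL rung, ∃-side of a HYPOTHETICAL filament-type rotating-self-similar blow-up skeleton; nothing here is a claim
about Navier–Stokes regularity or blow-up.  References: Cabré–Fontich–de la Llave, Indiana Univ. Math. J. 52 (2003) (parameterization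
method I, Thm 1.1); Kalies–Kepley–Mireles James, SIAM J. Appl. Dyn. Syst. 17 (2018) §3 (the invariance equation, tree file
`ParameterizationMethod`); Coddington–Levinson (1955) Ch. 13 Thm 4.1.
-/

set_option linter.dupNamespace false -- `NavierStokesRegularity.NavierStokesRegularity` path/namespace repetition is the tree convention

noncomputable section

namespace Summit.NavierStokesRegularity.NavierStokesRegularity.Theorems.SkeletonJ1RUnstableCurve

open Set Function Filter Metric NormedSpace Asymptotics
open Literature.Analysis.ODE (IsInvarianceSolutionOn)
open scoped Topology

variable {E : Type*} [NormedAddCommGroup E] [NormedSpace ℝ E] [CompleteSpace E]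

/-! ## §1 The unstable curve -/

/-- **THE `C¹` UNSTABLE CURVE OF AN EQUILIBRIUM BY THE PARAMETERIZATION METHOD.**  Let `f` vanish at `p`, be differentiable on `B(p, ρ₀)`
with `‖Df(y) − Df(p)‖ ≤ ω‖y − p‖`, and let `Π` split off the eigenvector `ξ` of `A = Df(p)` with eigenvalue `λ > 0`: `Π ξ = 0`,
`(A − λ)(1 − Π) = 0` (stated as `A v − A Πv = λ(v − Πv)`), and `‖exp(tA) Π v‖ ≤ C e^{λt} ‖Π v‖` for `t ≥ 0` (implied by the usual
exponential-dichotomy bound `≤ C e^{βt} ‖Π v‖` with `β ≤ λ`; no spectral GAP is needed for existence — uniqueness of the curve, which needs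
`β < λ`, is not claimed here).  Then for every `R > 0` there
are `δ > 0`, `C₁ ≥ 0` and `P, P′ : ℝ → E` with `P(0) = p`, `P′(0) = ξ`, `HasDerivAt P (P′ s) s` and `P′` continuous on `(−δ, δ)` (so `P` is
`C¹` there), solving the singular invariance equation `λ s · P′(s) = f(P(s))` on `(−δ, δ)`, with the cone/tangency bounds
`‖P(s) − p − sξ‖ ≤ R|s|`, `‖P(s) − p − sξ‖ ≤ C₁ s²`, `‖P′(s) − ξ‖ ≤ C₁|s|`, and `P(s) ∈ B(p, ρ₀)`.
[cite: CoddingtonLevinson1955, Ch. 13 Thm 4.1 (stable manifolds); here by the parameterization method, Cabré–Fontich–de la Llave 2003 Thm 1.1] -/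
theorem exists_unstableCurve {f : E → E} {f' : E → E →L[ℝ] E} {Pr : E →L[ℝ] E} {p ξ : E} {lam C ω ρ₀ R : ℝ}
    (hlam : 0 < lam) (hω : 0 ≤ ω) (hρ₀ : 0 < ρ₀) (hR : 0 < R)
    (hf0 : f p = 0) (hfd : ∀ y ∈ ball p ρ₀, HasFDerivAt f (f' y) y)
    (hlip : ∀ y ∈ ball p ρ₀, ‖f' y - f' p‖ ≤ ω * ‖y - p‖)
    (hPrξ : Pr ξ = 0) (hAPr : ∀ v, f' p v - f' p (Pr v) = lam • (v - Pr v))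
    (hexpA : ∀ t : ℝ, 0 ≤ t → ∀ v : E, ‖exp (t • f' p) (Pr v)‖ ≤ C * Real.exp (lam * t) * ‖Pr v‖) :
    ∃ δ C₁ : ℝ, ∃ P P' : ℝ → E, 0 < δ ∧ 0 ≤ C₁ ∧ P 0 = p ∧ P' 0 = ξ ∧
      (∀ s ∈ Ioo (-δ) δ, HasDerivAt P (P' s) s) ∧ ContinuousOn P' (Ioo (-δ) δ) ∧
      (∀ s ∈ Ioo (-δ) δ, (lam * s) • P' s = f (P s)) ∧
      (∀ s ∈ Ioo (-δ) δ, ‖P s - p - s • ξ‖ ≤ R * |s|) ∧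
      (∀ s ∈ Ioo (-δ) δ, ‖P s - p - s • ξ‖ ≤ C₁ * s ^ 2) ∧
      (∀ s ∈ Ioo (-δ) δ, ‖P' s - ξ‖ ≤ C₁ * |s|) ∧
      (∀ s ∈ Ioo (-δ) δ, P s ∈ ball p ρ₀) := by
  set A : E →L[ℝ] E := f' p with hA
  set K₀ : E →L[ℝ] E := lam⁻¹ • A - 1 with hK₀
  have hK₀w : ∀ w, K₀ w = lam⁻¹ • A w - w := fun w => rfl
  have hK₀Pr : ∀ v, K₀ (Pr v) = K₀ v := by
    intro v
    have h : lam⁻¹ • A v - lam⁻¹ • A (Pr v) = v - Pr v := by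
      rw [← smul_sub, hAPr v, smul_smul, inv_mul_cancel₀ hlam.ne', one_smul]
    rw [hK₀w, hK₀w]
    exact (sub_eq_sub_iff_sub_eq_sub.1 h).symm
  have hbound : ∀ t : ℝ, 0 ≤ t → ∀ v : E, ‖exp (t • K₀) (Pr v)‖ ≤ C * ‖Pr v‖ :=
    norm_exp_smul_branchK_apply_le hlam hexpA
  -- the window `δ₀` with `δ₀ (‖ξ‖ + R) < ρ₀`, and the two nonlinearities `H_±`
  set δ₀ : ℝ := ρ₀ / (2 * (‖ξ‖ + R + 1)) with hδ₀def
  have hδ₀ : 0 < δ₀ := by positivity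
  have hρ : δ₀ * (‖ξ‖ + R) < ρ₀ := by
    have h1 : δ₀ * (‖ξ‖ + R) ≤ δ₀ * (‖ξ‖ + R + 1) := mul_le_mul_of_nonneg_left (by linarith) hδ₀.le
    have h2 : δ₀ * (‖ξ‖ + R + 1) = ρ₀ / 2 := by rw [hδ₀def]; field_simp
    linarith
  have hM : 0 ≤ ω * (‖ξ‖ + R) ^ 2 / lam := by positivity
  have hL : 0 ≤ ω * (‖ξ‖ + R) / lam := by positivity
  obtain ⟨hMP, hLP, hcP⟩ := branchH_estimates (σ := 1) (δ₀ := δ₀)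
    (H := fun s q => (1 : ℝ) • ((lam * s ^ 2)⁻¹ • (f (p + ((1 : ℝ) * s) • q) - A (((1 : ℝ) * s) • q))))
    hlam hω hR.le (Or.inl rfl) hρ hf0 hfd hlip (fun _ _ => rfl)
  obtain ⟨hMM, hLM, hcM⟩ := branchH_estimates (σ := -1) (δ₀ := δ₀)
    (H := fun s q => (-1 : ℝ) • ((lam * s ^ 2)⁻¹ • (f (p + ((-1 : ℝ) * s) • q) - A (((-1 : ℝ) * s) • q))))
    hlam hω hR.le (Or.inr rfl) hρ hf0 hfd hlip (fun _ _ => rfl)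
  obtain ⟨δP, CP, qP, qP', hδP, hδPle, hCP, hqP0, hqPc, hqPR, hqPlin, hqPd, hqP'c, hqPode, hqP'b⟩ :=
    exists_singularBranch hδ₀ hM hL hR hK₀Pr hPrξ hbound hcP hMP hLP
  obtain ⟨δM, CM, qM, qM', hδM, hδMle, hCM, hqM0, hqMc, hqMR, hqMlin, hqMd, hqM'c, hqMode, hqM'b⟩ :=
    exists_singularBranch hδ₀ hM hL hR hK₀Pr hPrξ hbound hcM hMM hLM
  -- the two-sided curve
  set δ : ℝ := min δP δM with hδdef
  have hδ : 0 < δ := lt_min hδP hδM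
  set Cm : ℝ := max CP CM with hCm
  have hCm0 : 0 ≤ Cm := hCP.trans (le_max_left _ _)
  set q : ℝ → E := fun s => if 0 ≤ s then qP s else qM (-s) with hqdef
  set P : ℝ → E := fun s => p + s • q s with hPdef
  set P' : ℝ → E := fun s => if 0 ≤ s then qP s + s • qP' s else qM (-s) + (-s) • qM' (-s) with hP'def
  -- memberships
  have hpos : ∀ {s}, s ∈ Ioo (-δ) δ → 0 < s → s ∈ Ioo 0 δP := fun hs hs0 =>
    ⟨hs0, lt_of_lt_of_le hs.2 (min_le_left _ _)⟩
  have hneg : ∀ {s}, s ∈ Ioo (-δ) δ → s < 0 → -s ∈ Ioo 0 δM := fun hs hs0 =>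
    ⟨neg_pos.2 hs0, by have := hs.1; have := min_le_right δP δM; linarith⟩
  have hpos' : ∀ {s}, s ∈ Ioo (-δ) δ → 0 ≤ s → s ∈ Icc 0 δP := fun hs hs0 =>
    ⟨hs0, (lt_of_lt_of_le hs.2 (min_le_left _ _)).le⟩
  have hneg' : ∀ {s}, s ∈ Ioo (-δ) δ → s < 0 → -s ∈ Icc 0 δM := fun hs hs0 =>
    Ioo_subset_Icc_self (hneg hs hs0)
  -- `‖q s − ξ‖ ≤ R` and `≤ Cm |s|`
  have hqR : ∀ s ∈ Ioo (-δ) δ, ‖q s - ξ‖ ≤ R := by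
    intro s hs
    by_cases hs0 : 0 ≤ s
    · simp only [hqdef, if_pos hs0]; exact hqPR s (hpos' hs hs0)
    · simp only [hqdef, if_neg hs0]; exact hqMR (-s) (hneg' hs (lt_of_not_ge hs0))
  have hqlin : ∀ s ∈ Ioo (-δ) δ, ‖q s - ξ‖ ≤ Cm * |s| := by
    intro s hs
    by_cases hs0 : 0 ≤ s
    · simp only [hqdef, if_pos hs0]
      rw [abs_of_nonneg hs0]
      exact (hqPlin s (hpos' hs hs0)).trans (mul_le_mul_of_nonneg_right (le_max_left _ _) hs0)
    · have hs0' : s < 0 := lt_of_not_ge hs0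
      simp only [hqdef, if_neg hs0]
      rw [abs_of_neg hs0']
      exact (hqMlin (-s) (hneg' hs hs0')).trans (mul_le_mul_of_nonneg_right (le_max_right _ _) (neg_pos.2 hs0').le)
  -- `‖|s| q′‖ ≤ Cm |s|` in the form needed for `P′`
  have hP'sub : ∀ s ∈ Ioo (-δ) δ, ‖P' s - ξ‖ ≤ 2 * Cm * |s| := by
    intro s hs
    by_cases hs0 : 0 ≤ s
    · simp only [hP'def, if_pos hs0]
      rcases hs0.eq_or_lt with h0 | h0
      · rw [← h0]; simp [hqP0]
      · have h1 := hqP'b s (hpos hs h0)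
        have h2 := hqlin s hs
        simp only [hqdef, if_pos hs0] at h2
        rw [abs_of_pos h0] at h2 ⊢
        calc ‖qP s + s • qP' s - ξ‖ = ‖(qP s - ξ) + s • qP' s‖ := by abel_nf
          _ ≤ ‖qP s - ξ‖ + ‖s • qP' s‖ := norm_add_le _ _
          _ ≤ Cm * s + CP * s := add_le_add h2 h1
          _ ≤ 2 * Cm * s := by nlinarith [le_max_left CP CM, h0.le]
    · have hs0' : s < 0 := lt_of_not_ge hs0
      simp only [hP'def, if_neg hs0]
      have h1 := hqM'b (-s) (hneg hs hs0')
      have h2 := hqlin s hs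
      simp only [hqdef, if_neg hs0] at h2
      rw [abs_of_neg hs0'] at h2 ⊢
      calc ‖qM (-s) + (-s) • qM' (-s) - ξ‖ = ‖(qM (-s) - ξ) + (-s) • qM' (-s)‖ := by abel_nf
        _ ≤ ‖qM (-s) - ξ‖ + ‖(-s) • qM' (-s)‖ := norm_add_le _ _
        _ ≤ Cm * (-s) + CM * (-s) := add_le_add h2 h1
        _ ≤ 2 * Cm * (-s) := by nlinarith [le_max_right CP CM, neg_pos.2 hs0']
  have hP0 : P 0 = p := by simp only [hPdef, zero_smul, add_zero]
  have hP'0 : P' 0 = ξ := by simp only [hP'def, if_pos le_rfl, zero_smul, add_zero, hqP0]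
  -- derivative away from `0`
  have hderiv_pos : ∀ s ∈ Ioo (-δ) δ, 0 < s → HasDerivAt P (P' s) s := by
    intro s hs hs0
    have hd : HasDerivAt (fun y => p + y • qP y) (P' s) s := by
      have h := ((hasDerivAt_id s).smul (hqPd s (hpos hs hs0))).const_add p
      refine h.congr_deriv ?_
      simp only [hP'def, if_pos hs0.le, id, one_smul]; abel
    refine hd.congr_of_eventuallyEq ?_
    filter_upwards [Ioi_mem_nhds hs0] with y hy
    simp only [hPdef, hqdef, if_pos (le_of_lt (mem_Ioi.1 hy))]
  have hderiv_neg : ∀ s ∈ Ioo (-δ) δ, s < 0 → HasDerivAt P (P' s) s := by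
    intro s hs hs0
    have hqn : HasDerivAt (fun y => qM (-y)) ((-1 : ℝ) • qM' (-s)) s :=
      (hqMd (-s) (hneg hs hs0)).scomp s (hasDerivAt_neg s)
    have hd : HasDerivAt (fun y => p + y • qM (-y)) (P' s) s := by
      have h := ((hasDerivAt_id s).smul hqn).const_add p
      refine h.congr_deriv ?_
      simp only [hP'def, if_neg (not_le.2 hs0), id, one_smul, smul_smul, mul_neg_one]
      abel
    refine hd.congr_of_eventuallyEq ?_
    filter_upwards [Iio_mem_nhds hs0] with y hy
    simp only [hPdef, hqdef, if_neg (not_le.2 (mem_Iio.1 hy))]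
  -- derivative at `0`: `P(h) − p − h ξ = h (q h − ξ) = O(h²)`
  have hderiv_zero : HasDerivAt P ξ 0 := by
    rw [hasDerivAt_iff_isLittleO_nhds_zero]
    refine isLittleO_iff.2 fun ε hε => ?_
    have hη : 0 < min δ (ε / (Cm + 1)) := lt_min hδ (by positivity)
    filter_upwards [Metric.ball_mem_nhds (0 : ℝ) hη] with h hh
    rw [mem_ball, dist_zero_right, Real.norm_eq_abs, lt_min_iff] at hh
    have hmem : h ∈ Ioo (-δ) δ := by constructor <;> [linarith [neg_abs_le h, hh.1]; exact lt_of_le_of_lt (le_abs_self h) hh.1]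
    have e : P (0 + h) - P 0 - h • ξ = h • (q h - ξ) := by
      simp only [hPdef, zero_add, zero_smul, add_zero, smul_sub]; abel
    rw [e, norm_smul, Real.norm_eq_abs, mul_comm]
    refine mul_le_mul_of_nonneg_right ?_ (abs_nonneg h)
    calc ‖q h - ξ‖ ≤ Cm * |h| := hqlin h hmem
      _ ≤ Cm * (ε / (Cm + 1)) := mul_le_mul_of_nonneg_left hh.2.le hCm0
      _ ≤ ε := by rw [mul_div_assoc']; exact div_le_of_le_mul₀ (by positivity) hε.le (by nlinarith)
  have hderiv : ∀ s ∈ Ioo (-δ) δ, HasDerivAt P (P' s) s := by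
    intro s hs
    rcases lt_trichotomy s 0 with h | h | h
    · exact hderiv_neg s hs h
    · rw [h, hP'0]; exact hderiv_zero
    · exact hderiv_pos s hs h
  -- continuity of `P′`
  have hP'c : ContinuousOn P' (Ioo (-δ) δ) := by
    intro s hs
    rcases lt_trichotomy s 0 with h | h | h
    · have hc1 : ContinuousAt (fun y => qM (-y) + (-y) • qM' (-y)) s := by
        have hqc : ContinuousAt qM (-s) := hqMc.continuousAt (Icc_mem_nhds (hneg hs h).1 (hneg hs h).2)
        have hq'c : ContinuousAt qM' (-s) := hqM'c.continuousAt (Ioo_mem_nhds (hneg hs h).1 (hneg hs h).2)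
        exact (hqc.comp (continuous_neg.continuousAt)).add
          ((continuous_neg.continuousAt).smul (hq'c.comp continuous_neg.continuousAt))
      refine (hc1.congr ?_).continuousWithinAt
      filter_upwards [Iio_mem_nhds h] with y hy
      simp only [hP'def, if_neg (not_le.2 (mem_Iio.1 hy))]
    · subst h
      rw [Metric.continuousWithinAt_iff]
      intro ε hε
      refine ⟨ε / (2 * Cm + 1), by positivity, fun y hy hyd => ?_⟩
      rw [dist_eq_norm, hP'0]
      rw [dist_zero_right, Real.norm_eq_abs] at hyd
      calc ‖P' y - ξ‖ ≤ 2 * Cm * |y| := hP'sub y hy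
        _ ≤ (2 * Cm + 1) * |y| := by nlinarith [abs_nonneg y]
        _ < (2 * Cm + 1) * (ε / (2 * Cm + 1)) := mul_lt_mul_of_pos_left hyd (by positivity)
        _ = ε := by field_simp
    · have hc1 : ContinuousAt (fun y => qP y + y • qP' y) s := by
        have hqc : ContinuousAt qP s := hqPc.continuousAt (Icc_mem_nhds (hpos hs h).1 (hpos hs h).2)
        have hq'c : ContinuousAt qP' s := hqP'c.continuousAt (Ioo_mem_nhds (hpos hs h).1 (hpos hs h).2)
        exact hqc.add (continuousAt_id.smul hq'c)
      refine (hc1.congr ?_).continuousWithinAt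
      filter_upwards [Ioi_mem_nhds h] with y hy
      simp only [hP'def, if_pos (le_of_lt (mem_Ioi.1 hy))]
  -- the invariance equation
  have hinv : ∀ s ∈ Ioo (-δ) δ, (lam * s) • P' s = f (P s) := by
    intro s hs
    rcases lt_trichotomy s 0 with h | h | h
    · have hode := hqMode (-s) (hneg hs h)
      simp only [hP'def, hPdef, hqdef, if_neg (not_le.2 h)]
      have key := smul_add_eq_of_branchODE (A := A) (σ := -1) (u := -s) (q := qM (-s)) (q' := qM' (-s))
        (w := f (p + ((-1) * (-s)) • qM (-s)) - A (((-1) * (-s)) • qM (-s))) hlam.ne' (neg_ne_zero.2 h.ne) (by norm_num)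
        (by simpa only using hode)
      simp only [neg_mul, one_mul, neg_neg, map_smul] at key
      rw [key]; abel
    · subst h; simp [hP0, hf0]
    · have hode := hqPode s (hpos hs h)
      simp only [hP'def, hPdef, hqdef, if_pos h.le]
      have key := smul_add_eq_of_branchODE (A := A) (σ := 1) (u := s) (q := qP s) (q' := qP' s)
        (w := f (p + ((1 : ℝ) * s) • qP s) - A (((1 : ℝ) * s) • qP s)) hlam.ne' h.ne' (by norm_num)
        (by simpa only using hode)
      simp only [one_mul, map_smul] at key
      rw [key]; abel
  -- cone / tangency / ball
  have hcone : ∀ s ∈ Ioo (-δ) δ, ‖P s - p - s • ξ‖ ≤ R * |s| := by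
    intro s hs
    have e : P s - p - s • ξ = s • (q s - ξ) := by simp only [hPdef, smul_sub]; abel
    rw [e, norm_smul, Real.norm_eq_abs, mul_comm]
    exact mul_le_mul_of_nonneg_right (hqR s hs) (abs_nonneg s)
  have hquad : ∀ s ∈ Ioo (-δ) δ, ‖P s - p - s • ξ‖ ≤ 2 * Cm * s ^ 2 := by
    intro s hs
    have e : P s - p - s • ξ = s • (q s - ξ) := by simp only [hPdef, smul_sub]; abel
    rw [e, norm_smul, Real.norm_eq_abs]
    calc |s| * ‖q s - ξ‖ ≤ |s| * (Cm * |s|) := mul_le_mul_of_nonneg_left (hqlin s hs) (abs_nonneg s)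
      _ = Cm * s ^ 2 := by rw [← sq_abs]; ring
      _ ≤ 2 * Cm * s ^ 2 := by nlinarith [sq_nonneg s]
  have hball : ∀ s ∈ Ioo (-δ) δ, P s ∈ ball p ρ₀ := by
    intro s hs
    rw [mem_ball, dist_eq_norm]
    have e : P s - p = s • q s := by simp only [hPdef]; abel
    have hsδ : |s| ≤ δ₀ := (abs_lt.2 hs).le.trans ((min_le_left _ _).trans hδPle)
    have hqs : ‖q s‖ ≤ ‖ξ‖ + R := by
      calc ‖q s‖ = ‖ξ + (q s - ξ)‖ := by rw [add_sub_cancel]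
        _ ≤ ‖ξ‖ + ‖q s - ξ‖ := norm_add_le _ _
        _ ≤ ‖ξ‖ + R := by gcongr; exact hqR s hs
    rw [e, norm_smul, Real.norm_eq_abs]
    calc |s| * ‖q s‖ ≤ δ₀ * (‖ξ‖ + R) := mul_le_mul hsδ hqs (norm_nonneg _) hδ₀.le
      _ < ρ₀ := hρ
  exact ⟨δ, 2 * Cm, P, P', hδ, by positivity, hP0, hP'0, hderiv, hP'c, hinv, hcone, hquad, hP'sub, hball⟩

/-! ## §2 Consequences: the parameterization currency and the unstable streamline -/

omit [CompleteSpace E] in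
/-- A solution of `λ s P′(s) = f(P(s))` with `HasDerivAt P (P′ s) s` on `B` is an `IsInvarianceSolutionOn f (λ•1) P P′ B` in the sense of
`Literature.Analysis.ODE.ParameterizationMethod` (parameter space `ℝ`, linear field `Λ = λ`). [cite: KaliesKepleyJames2017, §3 eq. (3.1)] -/
theorem isInvarianceSolutionOn_of_hasDerivAt {f : E → E} {P P' : ℝ → E} {lam : ℝ} {B : Set ℝ}
    (hd : ∀ s ∈ B, HasDerivAt P (P' s) s) (heq : ∀ s ∈ B, (lam * s) • P' s = f (P s)) :
    IsInvarianceSolutionOn f (lam • (1 : ℝ →L[ℝ] ℝ)) P (fun s => (1 : ℝ →L[ℝ] ℝ).smulRight (P' s)) B := by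
  intro s hs
  refine ⟨(hd s hs).hasFDerivAt, ?_⟩
  rw [← heq s hs, ContinuousLinearMap.smulRight_apply]
  rfl

/-- **THE UNSTABLE STREAMLINE THROUGH `p` TANGENT TO `ξ`.**  Under the hypotheses of `exists_unstableCurve` there are `δ > 0` and a curve
`P` with `P(0) = p`, `P′(0) = ξ`, `P((−δ, δ)) ⊆ B(p, ρ₀)`, such that for every `s₀ ∈ (−δ, δ)` the reparametrised curve
`x(t) = P(s₀ e^{λt})` solves `x′ = f(x)` for all `t ≤ 0` and `x(t) → p` as `t → −∞` (the Parameterization Lemma,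
`Literature.Analysis.ODE.IsInvarianceSolutionOn.hasDerivAt_comp`, and `tendsto_comp_of_tendsto_zero`).
[cite: KaliesKepleyJames2017, §3 Lemma 3.1] -/
theorem exists_unstableCurve_trajectory {f : E → E} {f' : E → E →L[ℝ] E} {Pr : E →L[ℝ] E} {p ξ : E} {lam C ω ρ₀ : ℝ}
    (hlam : 0 < lam) (hω : 0 ≤ ω) (hρ₀ : 0 < ρ₀)
    (hf0 : f p = 0) (hfd : ∀ y ∈ ball p ρ₀, HasFDerivAt f (f' y) y)
    (hlip : ∀ y ∈ ball p ρ₀, ‖f' y - f' p‖ ≤ ω * ‖y - p‖)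
    (hPrξ : Pr ξ = 0) (hAPr : ∀ v, f' p v - f' p (Pr v) = lam • (v - Pr v))
    (hexpA : ∀ t : ℝ, 0 ≤ t → ∀ v : E, ‖exp (t • f' p) (Pr v)‖ ≤ C * Real.exp (lam * t) * ‖Pr v‖) :
    ∃ δ : ℝ, ∃ P : ℝ → E, 0 < δ ∧ P 0 = p ∧ HasDerivAt P ξ 0 ∧ (∀ s ∈ Ioo (-δ) δ, P s ∈ ball p ρ₀) ∧
      ∀ s₀ ∈ Ioo (-δ) δ,
        (∀ t : ℝ, t ≤ 0 → HasDerivAt (fun τ => P (s₀ * Real.exp (lam * τ))) (f (P (s₀ * Real.exp (lam * t)))) t) ∧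
        Tendsto (fun t => P (s₀ * Real.exp (lam * t))) atBot (𝓝 p) := by
  obtain ⟨δ, C₁, P, P', hδ, -, hP0, hP'0, hd, -, heq, -, -, -, hball⟩ :=
    exists_unstableCurve (R := 1) hlam hω hρ₀ one_pos hf0 hfd hlip hPrξ hAPr hexpA
  have hinv := isInvarianceSolutionOn_of_hasDerivAt hd heq
  have hd0 : HasDerivAt P ξ 0 := by have h := hd 0 ⟨by linarith, hδ⟩; rwa [hP'0] at h
  refine ⟨δ, P, hδ, hP0, hd0, hball, fun s₀ hs₀ => ⟨fun t ht => ?_, ?_⟩⟩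
  · -- `σ(t) = s₀ e^{λt}` solves `σ′ = λ σ` and stays in `(−δ, δ)` for `t ≤ 0`
    have hσ : HasDerivAt (fun τ => s₀ * Real.exp (lam * τ)) ((lam • (1 : ℝ →L[ℝ] ℝ)) (s₀ * Real.exp (lam * t))) t := by
      have h := ((hasDerivAt_id t).const_mul lam).exp.const_mul s₀
      simp only [id, mul_one] at h
      refine h.congr_deriv ?_
      show s₀ * (Real.exp (lam * t) * lam) = lam * (s₀ * Real.exp (lam * t))
      ring
    have hmem : s₀ * Real.exp (lam * t) ∈ Ioo (-δ) δ := by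
      have he : 0 < Real.exp (lam * t) := Real.exp_pos _
      have he1 : Real.exp (lam * t) ≤ 1 := Real.exp_le_one_iff.2 (by nlinarith)
      have hab : |s₀ * Real.exp (lam * t)| < δ := by
        rw [abs_mul, abs_of_pos he]
        exact lt_of_le_of_lt (mul_le_of_le_one_right (abs_nonneg _) he1) (abs_lt.2 hs₀)
      exact abs_lt.1 hab
    exact hinv.hasDerivAt_comp hσ hmem
  · have hσ0 : Tendsto (fun t : ℝ => s₀ * Real.exp (lam * t)) atBot (𝓝 0) := by
      have h := (Real.tendsto_exp_atBot.comp (tendsto_id.const_mul_atBot hlam)).const_mul s₀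
      simpa using h
    have h := Literature.Analysis.ODE.tendsto_comp_of_tendsto_zero (P := P) hd0.continuousAt hσ0
    rwa [hP0] at h

end Summit.NavierStokesRegularity.NavierStokesRegularity.Theorems.SkeletonJ1RUnstableCurve

end
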